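import Summits.AtomisticToContinuum.Crystallization.Theorems.FrustratedLawDichotomyStrainedPatchHomCurvCoeffW
import Summits.AtomisticToContinuum.Crystallization.Theorems.FrustratedLawDichotomyStrainedPatchHomCurvRegime

/-!
# Per-label curvature coefficients in the kernel: REGIME DISPATCH (hull over the regimes a `q`-enclosure can meet) and its soundness

decomp-a2c hand-1 g26 (crux `AperiodicFrustratedLawGap`, stmt-AtomisticToContinuum-27623; `λ`-leaf of lever (C), critic rows 1026 (C) / 1030).
Given an enclosure `Q ∋ q = ρ²` of one label's squared radius, `coeffFI Q = some (A, B)` encloses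
`α(ρ) = (W₄₅″(ρ) − W₄₅′(ρ)/ρ)/ρ²` in `A` and `β(ρ) = W₄₅′(ρ)/ρ` in `B` for EVERY `ρ > 0` off the junction radii with `ρ² ∈ Q`: the regime formulas
of `…HomCurvCoeff(W)` are evaluated on `Q` and HULLED over all regimes the interval can meet (`canB/canL/canW/canF`, end-point comparisons with
`64/25`, `9`, `81/4`), so labels straddling a junction are sound without case analysis in the leaf (critic row 1026 guard, option 2 analogue).
★★★ `mem_coeffFI`.  With `…HomCurvKit.curvatureSum_ge_of_domTest` and `…HomConvexCurvature.segGd_eq_rankOne` this is the per-label input of the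
curvature certificate.  Kernel definitions + soundness; 0 sorry; standard axioms; no instances / notation / `#eval`.  `--supports stmt-AtomisticToContinuum-27623`.
-/

noncomputable section

namespace Summit.AtomisticToContinuum.Crystallization.Theorems.FrustratedLawDichotomyStrainedPatchHomCurvCoeff

open Literature.Analysis.ValidatedNumerics.Numerics
open Summit.AtomisticToContinuum.Crystallization.Theorems.FrustratedLawDichotomySchurCut (effPot w₄₅ ω₄)
open Summit.AtomisticToContinuum.Crystallization.Theorems.FrustratedLawDichotomyStrainedPatchHomForceKit (phiFI mem_phiFI)
open Summit.AtomisticToContinuum.Crystallization.Theorems.FrustratedLawDichotomyStrainedPatchHomCurvRegime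
open Summit.AtomisticToContinuum.Crystallization.Theorems.FrustratedLawDichotomyStrainedPatchTaylorLeaves (junctions)

/-! ## §5. Regime flags -/

/-- The bump regime may be met: `Q.lo < ⌈(64/25)·SC⌉`. -/
def canB (Q : FI) : Bool := decide (Q.lo < (FI.ofFrac 64 25).hi)
/-- The Lennard-Jones regime may be met. -/
def canL (Q : FI) : Bool := decide ((FI.ofFrac 64 25).lo < Q.hi ∧ Q.lo < (FI.ofInt 9).hi)
/-- The window regime may be met. -/
def canW (Q : FI) : Bool := decide ((FI.ofInt 9).lo < Q.hi ∧ Q.lo < (FI.ofFrac 81 4).hi)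
/-- The far regime may be met. -/
def canF (Q : FI) : Bool := decide ((FI.ofFrac 81 4).lo < Q.hi)

/-- `q < t` with `q ∈ Q`, `t ∈ T` forces `Q.lo < T.hi`. [folklore] -/
theorem lo_lt_hi_of_lt {q t : ℝ} {Q T : FI} (hq : FI.mem q Q) (ht : FI.mem t T) (h : q < t) : Q.lo < T.hi := by
  have hS : (0 : ℝ) < SC := by norm_num [SC]
  have h1 : (Q.lo : ℝ) < (T.hi : ℝ) := by
    calc (Q.lo : ℝ) ≤ q * SC := hq.1
      _ < t * SC := by nlinarith
      _ ≤ T.hi := ht.2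
  exact_mod_cast h1

/-- The bump flag is raised by a bump-regime radius. [folklore] -/
theorem canB_of {ρ : ℝ} {Q : FI} (hq : FI.mem (ρ ^ 2) Q) (h0 : 0 < ρ) (h : ρ < 8 / 5) : canB Q = true := by
  have ht : FI.mem ((64 : ℤ) / (25 : ℕ) : ℝ) (FI.ofFrac 64 25) := FI.mem_ofFrac 64 (by norm_num)
  have hlt : ρ ^ 2 < ((64 : ℤ) / (25 : ℕ) : ℝ) := by push_cast; nlinarith
  simp only [canB, decide_eq_true_eq]
  exact lo_lt_hi_of_lt hq ht hlt

/-- The Lennard-Jones flag is raised by a radius in that regime. [folklore] -/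
theorem canL_of {ρ : ℝ} {Q : FI} (hq : FI.mem (ρ ^ 2) Q) (h1 : 8 / 5 < ρ) (h2 : ρ < 3) : canL Q = true := by
  have ht1 : FI.mem ((64 : ℤ) / (25 : ℕ) : ℝ) (FI.ofFrac 64 25) := FI.mem_ofFrac 64 (by norm_num)
  have ht2 : FI.mem ((9 : ℤ) : ℝ) (FI.ofInt 9) := FI.mem_ofInt 9
  have hgt : ((64 : ℤ) / (25 : ℕ) : ℝ) < ρ ^ 2 := by push_cast; nlinarith
  have hlt : ρ ^ 2 < ((9 : ℤ) : ℝ) := by push_cast; nlinarith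
  simp only [canL, decide_eq_true_eq]
  exact ⟨lo_lt_hi_of_lt ht1 hq hgt, lo_lt_hi_of_lt hq ht2 hlt⟩

/-- The window flag is raised by a window-regime radius. [folklore] -/
theorem canW_of {ρ : ℝ} {Q : FI} (hq : FI.mem (ρ ^ 2) Q) (h1 : 3 < ρ) (h2 : ρ < 9 / 2) : canW Q = true := by
  have ht2 : FI.mem ((9 : ℤ) : ℝ) (FI.ofInt 9) := FI.mem_ofInt 9
  have ht3 : FI.mem ((81 : ℤ) / (4 : ℕ) : ℝ) (FI.ofFrac 81 4) := FI.mem_ofFrac 81 (by norm_num)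
  have hgt : ((9 : ℤ) : ℝ) < ρ ^ 2 := by push_cast; nlinarith
  have hlt : ρ ^ 2 < ((81 : ℤ) / (4 : ℕ) : ℝ) := by push_cast; nlinarith
  simp only [canW, decide_eq_true_eq]
  exact ⟨lo_lt_hi_of_lt ht2 hq hgt, lo_lt_hi_of_lt hq ht3 hlt⟩

/-- The far flag is raised by a far radius. [folklore] -/
theorem canF_of {ρ : ℝ} {Q : FI} (hq : FI.mem (ρ ^ 2) Q) (h : 9 / 2 < ρ) : canF Q = true := by
  have ht3 : FI.mem ((81 : ℤ) / (4 : ℕ) : ℝ) (FI.ofFrac 81 4) := FI.mem_ofFrac 81 (by norm_num)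
  have hgt : ((81 : ℤ) / (4 : ℕ) : ℝ) < ρ ^ 2 := by push_cast; nlinarith
  simp only [canF, decide_eq_true_eq]
  exact lo_lt_hi_of_lt ht3 hq hgt

/-! ## §6. Hull accumulation -/

/-- Insert `x` into the running hull when `flag`. -/
def pick (flag : Bool) (x : FI) (acc : Option FI) : Option FI :=
  if flag then (match acc with | none => some x | some y => some (y.hull x)) else acc

/-- Membership survives a `pick`. [folklore] -/
theorem mem_pick_of_mem {v : ℝ} {flag : Bool} {x y : FI} (h : FI.mem v y) {acc : Option FI} (hacc : acc = some y) :
    ∃ z, pick flag x acc = some z ∧ FI.mem v z := by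
  subst hacc
  unfold pick
  cases flag
  · exact ⟨y, by simp, h⟩
  · exact ⟨y.hull x, by simp, FI.mem_hull_left h x⟩

/-- A `pick` with `flag = true` contains its insert. [folklore] -/
theorem mem_pick_self {v : ℝ} {x : FI} (h : FI.mem v x) (acc : Option FI) : ∃ z, pick true x acc = some z ∧ FI.mem v z := by
  unfold pick
  cases acc with
  | none => exact ⟨x, by simp, h⟩
  | some y => exact ⟨y.hull x, by simp, FI.mem_hull_right h y⟩

/-- The hull over the applicable regimes of the four regime values `xB, xL, xW, 0`. -/
def sel (Q : FI) (xB xL xW : FI) : Option FI :=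
  pick (canF Q) (FI.ofInt 0) (pick (canW Q) xW (pick (canL Q) xL (pick (canB Q) xB none)))

/-- `sel` contains the bump value when the bump regime is met. [folklore] -/
theorem mem_sel_B {v : ℝ} {Q xB xL xW S : FI} (hB : canB Q = true) (hv : FI.mem v xB) (hS : sel Q xB xL xW = some S) : FI.mem v S := by
  unfold sel at hS
  obtain ⟨z1, hz1, hm1⟩ := mem_pick_self hv (none : Option FI)
  rw [hB] at hS
  obtain ⟨z2, hz2, hm2⟩ := mem_pick_of_mem (flag := canL Q) (x := xL) hm1 hz1
  obtain ⟨z3, hz3, hm3⟩ := mem_pick_of_mem (flag := canW Q) (x := xW) hm2 hz2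
  obtain ⟨z4, hz4, hm4⟩ := mem_pick_of_mem (flag := canF Q) (x := FI.ofInt 0) hm3 hz3
  rw [hz4] at hS
  cases hS
  exact hm4

/-- `sel` contains the Lennard-Jones value when that regime is met. [folklore] -/
theorem mem_sel_L {v : ℝ} {Q xB xL xW S : FI} (hL : canL Q = true) (hv : FI.mem v xL) (hS : sel Q xB xL xW = some S) : FI.mem v S := by
  unfold sel at hS
  rw [hL] at hS
  obtain ⟨z2, hz2, hm2⟩ := mem_pick_self hv (pick (canB Q) xB none)
  obtain ⟨z3, hz3, hm3⟩ := mem_pick_of_mem (flag := canW Q) (x := xW) hm2 hz2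
  obtain ⟨z4, hz4, hm4⟩ := mem_pick_of_mem (flag := canF Q) (x := FI.ofInt 0) hm3 hz3
  rw [hz4] at hS
  cases hS
  exact hm4

/-- `sel` contains the window value when that regime is met. [folklore] -/
theorem mem_sel_W {v : ℝ} {Q xB xL xW S : FI} (hW : canW Q = true) (hv : FI.mem v xW) (hS : sel Q xB xL xW = some S) : FI.mem v S := by
  unfold sel at hS
  rw [hW] at hS
  obtain ⟨z3, hz3, hm3⟩ := mem_pick_self hv (pick (canL Q) xL (pick (canB Q) xB none))
  obtain ⟨z4, hz4, hm4⟩ := mem_pick_of_mem (flag := canF Q) (x := FI.ofInt 0) hm3 hz3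
  rw [hz4] at hS
  cases hS
  exact hm4

/-- `sel` contains `0` when the far regime is met. [folklore] -/
theorem mem_sel_F {Q xB xL xW S : FI} (hF : canF Q = true) (hS : sel Q xB xL xW = some S) : FI.mem 0 S := by
  unfold sel at hS
  rw [hF] at hS
  have h0 : FI.mem (0 : ℝ) (FI.ofInt 0) := by simpa using FI.mem_ofInt 0
  obtain ⟨z4, hz4, hm4⟩ := mem_pick_self h0 (pick (canW Q) xW (pick (canL Q) xL (pick (canB Q) xB none)))
  rw [hz4] at hS
  cases hS
  exact hm4

/-! ## §7. ★★★ The dispatcher and its soundness -/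

/-- ★ **Per-label curvature coefficients** `(A ∋ α, B ∋ β)` from `Q ∋ ρ²`, hulled over the regimes `Q` can meet (`none` iff `Q` reaches `0` or is
empty of regimes). -/
def coeffFI (Q : FI) : Option (FI × FI) :=
  match alphaBumpFI Q, betaBumpFI Q, alphaLJFI Q, phiFI Q, alphaWinFI Q, betaWinFI Q with
  | some aB, some bB, some aL, some bL, some aW, some bW =>
    match sel Q aB aL aW, sel Q bB bL bW with
    | some A, some B => some (A, B)
    | _, _ => none
  | _, _, _, _, _, _ => none

/-- ★★★ **SOUNDNESS OF THE DISPATCHER**: for every `ρ > 0` off the junction radii with `ρ² ∈ Q`, `coeffFI Q = some (A, B)` encloses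
`α(ρ) = (W₄₅″(ρ) − W₄₅′(ρ)/ρ)/ρ² ∈ A` and `β(ρ) = W₄₅′(ρ)/ρ ∈ B` (`W₄₅ = effPot w₄₅ ω₄ (3/400) = Wrec`). [folklore chaining] -/
theorem mem_coeffFI {ρ : ℝ} (h0 : 0 < ρ) (hJ : ρ ∉ junctions) {Q : FI} (hq : FI.mem (ρ ^ 2) Q) {AB : FI × FI} (h : coeffFI Q = some AB) :
    FI.mem ((deriv (deriv (effPot w₄₅ ω₄ (3 / 400))) ρ - deriv (effPot w₄₅ ω₄ (3 / 400)) ρ / ρ) / ρ ^ 2) AB.1 ∧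
      FI.mem (deriv (effPot w₄₅ ω₄ (3 / 400)) ρ / ρ) AB.2 := by
  unfold coeffFI at h
  cases haB : alphaBumpFI Q with
  | none => rw [haB] at h; exact absurd h (by simp)
  | some aB =>
  cases hbB : betaBumpFI Q with
  | none => rw [haB, hbB] at h; exact absurd h (by simp)
  | some bB =>
  cases haL : alphaLJFI Q with
  | none => rw [haB, hbB, haL] at h; exact absurd h (by simp)
  | some aL =>
  cases hbL : phiFI Q with
  | none => rw [haB, hbB, haL, hbL] at h; exact absurd h (by simp)
  | some bL =>
  cases haW : alphaWinFI Q with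
  | none => rw [haB, hbB, haL, hbL, haW] at h; exact absurd h (by simp)
  | some aW =>
  cases hbW : betaWinFI Q with
  | none => rw [haB, hbB, haL, hbL, haW, hbW] at h; exact absurd h (by simp)
  | some bW =>
  rw [haB, hbB, haL, hbL, haW, hbW] at h
  simp only at h
  cases hSA : sel Q aB aL aW with
  | none => rw [hSA] at h; exact absurd h (by simp)
  | some A =>
  cases hSB : sel Q bB bL bW with
  | none => rw [hSA, hSB] at h; exact absurd h (by simp)
  | some B =>
  rw [hSA, hSB] at h
  simp only [Option.some.injEq] at h
  subst h
  rcases regime_cases h0 hJ with hb | hl | hw | hf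
  · have hc := canB_of hq hb.1 hb.2
    refine ⟨mem_sel_B hc ?_ hSA, mem_sel_B hc ?_ hSB⟩
    · rw [alpha_bump hb.1 hb.2]; exact mem_alphaBumpFI h0.le hq haB
    · rw [beta_bump hb.1 hb.2]; exact mem_betaBumpFI h0.le hq hbB
  · have hc := canL_of hq hl.1 hl.2
    refine ⟨mem_sel_L hc ?_ hSA, mem_sel_L hc ?_ hSB⟩
    · rw [alpha_lj hl.1 hl.2]; exact mem_alphaLJFI hq haL
    · rw [beta_lj hl.1 hl.2]; exact mem_phiFI hq hbL
  · have hc := canW_of hq hw.1 hw.2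
    refine ⟨mem_sel_W hc ?_ hSA, mem_sel_W hc ?_ hSB⟩
    · rw [alpha_window hw.1 hw.2]; exact mem_alphaWinFI h0.le hq haW
    · rw [beta_window hw.1 hw.2]; exact mem_betaWinFI h0.le hq hbW
  · have hc := canF_of hq hf
    refine ⟨?_, ?_⟩
    · rw [alpha_far hf]; exact mem_sel_F hc hSA
    · rw [beta_far hf]; exact mem_sel_F hc hSB

end Summit.AtomisticToContinuum.Crystallization.Theorems.FrustratedLawDichotomyStrainedPatchHomCurvCoeff

end
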